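import Literature.AlgebraicTopology.SingularHomology.IntegralBockstein
import Literature.AlgebraicTopology.SingularHomology.LocalHomologyCoeffChange
import Literature.AlgebraicTopology.SingularHomology.FundamentalClassExistence
import HarnessLib

/-!
# `ℤ/d`-coefficients: the two module structures agree, and the Bockstein divisibility criterion

Two small supplements to `IntegralBockstein.lean` / `LocalHomologyCoeffChange.lean`
(A. Hatcher, *Algebraic Topology* (2002), §2.2 p. 153 and §3.E p. 303):

* `isZero_singularHomology_int_zmod_iff` — the singular homology of `X` with coefficients in the
  group `ℤ/d` does not depend on whether `ℤ/d` is regarded as a `ℤ`-module or as a module over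
  itself, as far as vanishing is concerned: `Hₖ(X; ℤ/d)_ℤ = 0 ↔ Hₖ(X; ℤ/d)_{ℤ/d} = 0` (both are
  the homology of the same complex of abelian groups; formally, the identity of `ℤ/d` induces
  mutually inverse additive maps `clocalHomology.coeffMap` between the two concrete models). This
  lets mod-`2` Poincaré duality (a statement over the *ring* `ℤ/2`) feed the integral Bockstein
  sequence (a statement about `ℤ`-modules);
* `singularHomology.exists_zsmul_eq_of_isZero` — **Bockstein divisibility criterion**: if
  `Hₖ(X; ℤ/d) = 0` then every class of `Hₖ(X; ℤ)` is divisible by `d` (exactness of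
  `Hₖ(X; ℤ) →(d·) Hₖ(X; ℤ) → Hₖ(X; ℤ/d)`, the companion of
  `singularHomology.zsmul_right_injective_of_isZero`);
* `singularHomology.eq_zero_of_forall_exists_zsmul_of_injective` — a `2`-divisible class in a group
  embedding into `ℤ` is zero (the algebraic end of the argument `H₂(X; ℤ) ↪ ℤ`,
  `H₂(X; ℤ/2) = 0 ⇒ H₂(X; ℤ) = 0`).

Everything is proved; no named facts, no definitions.

## References

* A. Hatcher, *Algebraic Topology*, CUP 2002, §2.2 p. 153, §3.E p. 303 [HatcherAT2002].
-/

noncomputable section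

-- as in `SingularChainsConcrete` / `LocalHomology`: chains of the concrete complex are `Finsupp`s
set_option backward.isDefEq.respectTransparency false

open CategoryTheory Limits Set Function

universe u

namespace Literature.AlgebraicTopology.SingularHomology

variable {X : Type u} [TopologicalSpace X]

/-! ### Absolute homology as local homology at `univ` -/

/-- `Hₖ(X; M) ≅ Hₖ(X | X; M)` in the concrete model: `j_* : Hₖ(X) → Hₖ(X, X ∖ X)` is an
isomorphism (`X ∖ X = ∅`) and the two models of relative homology agree
(`localHomologyOfSet.cmpIso`). [folklore] -/
theorem nonempty_singularHomology_iso_clocalHomology_univ (R : Type) [CommRing R] (M : Type)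
    [AddCommGroup M] [Module R M] (k : ℕ) :
    Nonempty (singularHomology R M X k ≅ clocalHomology R M X (univ : Set X) k) := by
  haveI : IsEmpty ((univ : Set X)ᶜ : Set X) := ⟨fun x => absurd (mem_univ (x : X)) x.2⟩
  haveI := relativeSingularHomology.isIso_ofAbsolute_of_isEmpty R M (X := X) (univ : Set X)ᶜ k
  exact ⟨asIso (relativeSingularHomology.ofAbsolute R M X (univ : Set X)ᶜ k) ≪≫
    localHomologyOfSet.cmpIso R M X univ k⟩

/-! ### `ℤ/d` as a `ℤ`-module or as a ring: vanishing of homology agrees -/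

/-- **`Hₖ(X; ℤ/d) = 0` does not depend on the module structure put on the coefficient group
`ℤ/d`** (`ℤ`-module or module over itself): the identity of `ℤ/d` induces mutually inverse
additive maps between the two homology groups (`clocalHomology.coeffMap`, Hatcher 2002, §2.2
p. 153: homology with coefficients only depends on the coefficient *group*). [cite: HatcherAT2002, §2.2 p. 153] -/
theorem isZero_singularHomology_int_zmod_iff (d : ℕ) (k : ℕ) :
    IsZero (singularHomology ℤ (ZMod d) X k) ↔ IsZero (singularHomology (ZMod d) (ZMod d) X k) := by
  obtain ⟨e₁⟩ := nonempty_singularHomology_iso_clocalHomology_univ (X := X) ℤ (ZMod d) k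
  obtain ⟨e₂⟩ := nonempty_singularHomology_iso_clocalHomology_univ (X := X) (ZMod d) (ZMod d) k
  -- the two additive comparison maps induced by the identity of the coefficient group
  let φ : clocalHomology ℤ (ZMod d) X (univ : Set X) k →+ clocalHomology (ZMod d) (ZMod d) X (univ : Set X) k :=
    clocalHomology.coeffMap ℤ (ZMod d) (AddMonoidHom.id (ZMod d)) univ k
  let ψ : clocalHomology (ZMod d) (ZMod d) X (univ : Set X) k →+ clocalHomology ℤ (ZMod d) X (univ : Set X) k :=
    clocalHomology.coeffMap (ZMod d) ℤ (AddMonoidHom.id (ZMod d)) univ k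
  have hψφ : ∀ a, ψ (φ a) = a := by
    intro a
    change (ψ.comp φ) a = a
    rw [show ψ.comp φ = AddMonoidHom.id _ from by
      rw [← clocalHomology.coeffMap_comp (R' := ZMod d), AddMonoidHom.id_comp,
        clocalHomology.coeffMap_id]]
    rfl
  have hφψ : ∀ b, φ (ψ b) = b := by
    intro b
    change (φ.comp ψ) b = b
    rw [show φ.comp ψ = AddMonoidHom.id _ from by
      rw [← clocalHomology.coeffMap_comp (R' := ℤ), AddMonoidHom.id_comp,
        clocalHomology.coeffMap_id]]
    rfl
  rw [ModuleCat.isZero_iff_subsingleton, ModuleCat.isZero_iff_subsingleton,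
    e₁.toLinearEquiv.toEquiv.subsingleton_congr, e₂.toLinearEquiv.toEquiv.subsingleton_congr]
  constructor
  · intro h
    exact ⟨fun a b => by rw [← hφψ a, ← hφψ b, Subsingleton.elim (ψ a) (ψ b)]⟩
  · intro h
    exact ⟨fun a b => by rw [← hψφ a, ← hψφ b, Subsingleton.elim (φ a) (φ b)]⟩

/-! ### The Bockstein divisibility criterion -/

/-- **Bockstein divisibility criterion** (concrete singular homology): if `Hₖ(X; ℤ/d) = 0`,
`d ≥ 1`, then every class of `Hₖ(X; ℤ)` is `d` times a class — the segment
`Hₖ(X; ℤ) →(d·) Hₖ(X; ℤ) → Hₖ(X; ℤ/d)` of the long exact sequence of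
`0 → C_•(X; ℤ) →(d·) C_•(X; ℤ) → C_•(X; ℤ/d) → 0` is exact (Hatcher 2002, §3.E, p. 303).
[cite: HatcherAT2002, §3.E p. 303] -/
theorem csingularHomology.exists_zsmul_eq_of_isZero {d : ℕ} (hd : 0 < d) (k : ℕ)
    (hZ : IsZero (csingularHomology ℤ (ZMod d) X k)) (x : csingularHomology ℤ ℤ X k) :
    ∃ y : csingularHomology ℤ ℤ X k, (d : ℤ) • y = x := by
  have hfg := Int.exact_zsmul_cast_zmod d
  have hf : Function.Injective ((d : ℤ) • (LinearMap.id : ℤ →ₗ[ℤ] ℤ)) := by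
    intro a b h
    have h' : (d : ℤ) * a = (d : ℤ) * b := by simpa [smul_eq_mul] using h
    exact mul_left_cancel₀ (by exact_mod_cast hd.ne') h'
  have hg : Function.Surjective (Int.castAddHom (ZMod d)).toIntLinearMap :=
    ZMod.intCast_surjective
  have hS := csingularChainComplex.coeffShortComplex_shortExact (X := X) _ _ hfg hf hg
  have hg0 : HomologicalComplex.homologyMap
      (csingularChainComplex.coeffShortComplex X ((d : ℤ) • (LinearMap.id : ℤ →ₗ[ℤ] ℤ))
        (Int.castAddHom (ZMod d)).toIntLinearMap hfg.linearMap_comp_eq_zero).g k = 0 :=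
    hZ.eq_of_tgt _ _
  have hepi := (hS.homology_exact₂ k).epi_f hg0
  -- the map `Hₖ(d • 𝟙) = d • 𝟙`
  have hmap : HomologicalComplex.homologyMap
      (csingularChainComplex.coeffShortComplex X ((d : ℤ) • (LinearMap.id : ℤ →ₗ[ℤ] ℤ))
        (Int.castAddHom (ZMod d)).toIntLinearMap hfg.linearMap_comp_eq_zero).f k =
      (d : ℤ) • 𝟙 (csingularHomology ℤ ℤ X k) := by
    change (HomologicalComplex.homologyFunctor _ _ k).map
      (csingularChainComplex.mapCoeff X ((d : ℤ) • (LinearMap.id : ℤ →ₗ[ℤ] ℤ))) = _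
    rw [csingularChainComplex.mapCoeff_zsmul_id, Functor.map_zsmul, CategoryTheory.Functor.map_id]
    rfl
  change Epi (HomologicalComplex.homologyMap
      (csingularChainComplex.coeffShortComplex X ((d : ℤ) • (LinearMap.id : ℤ →ₗ[ℤ] ℤ))
        (Int.castAddHom (ZMod d)).toIntLinearMap hfg.linearMap_comp_eq_zero).f k) at hepi
  rw [hmap, ModuleCat.epi_iff_surjective] at hepi
  obtain ⟨y, hy⟩ := hepi x
  refine ⟨y, ?_⟩
  change ((d : ℤ) • 𝟙 (csingularHomology ℤ ℤ X k)).hom y = x at hy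
  rw [ModuleCat.hom_zsmul, ModuleCat.hom_id] at hy
  exact hy

/-- **Bockstein divisibility criterion** for Mathlib's singular homology: if `Hₖ(X; ℤ/d) = 0`,
`d ≥ 1`, then every class of `Hₖ(X; ℤ)` is divisible by `d` (Hatcher 2002, §3.E, p. 303;
transported along `csingularHomology.compIso`). [cite: HatcherAT2002, §3.E p. 303] -/
theorem singularHomology.exists_zsmul_eq_of_isZero {d : ℕ} (hd : 0 < d) (k : ℕ)
    (hZ : IsZero (singularHomology ℤ (ZMod d) X k)) (x : singularHomology ℤ ℤ X k) :
    ∃ y : singularHomology ℤ ℤ X k, (d : ℤ) • y = x := by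
  have hZ' : IsZero (csingularHomology ℤ (ZMod d) X k) :=
    hZ.of_iso (csingularHomology.compIso ℤ (ZMod d) X k)
  let e := csingularHomology.compIso ℤ ℤ X k
  obtain ⟨y, hy⟩ := csingularHomology.exists_zsmul_eq_of_isZero hd k hZ' (e.inv x)
  refine ⟨e.hom y, ?_⟩
  have h := congrArg (fun z => e.hom z) hy
  simp only [map_zsmul] at h
  rw [e.inv_hom_id_apply] at h
  exact h

/-- **A `d`-divisible element of a group embedding into `ℤ` is zero** (`d ≥ 2`): if every
element of `G` is `d` times an element and `ι : G →+ ℤ` is injective then `G = 0`, since a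
non-zero integer is not divisible by arbitrarily high powers of `d`. [folklore] -/
theorem eq_zero_of_forall_exists_zsmul_of_injective {G : Type*} [AddCommGroup G] {d : ℤ}
    (hd : 2 ≤ d) (hdiv : ∀ x : G, ∃ y : G, d • y = x) (ι : G →+ ℤ) (hι : Function.Injective ι)
    (x : G) : x = 0 := by
  -- `|ι x|` is divisible by `d ^ n` for every `n`
  have key : ∀ (n : ℕ) (x : G), d ^ n ∣ ι x := by
    intro n
    induction n with
    | zero => intro x; simp
    | succ n ih =>
      intro x
      obtain ⟨y, rfl⟩ := hdiv x
      rw [map_zsmul, smul_eq_mul, pow_succ, mul_comm (d ^ n) d]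
      exact mul_dvd_mul_left d (ih y)
  by_contra hx
  have hιx : ι x ≠ 0 := fun h => hx (hι (by rw [h, map_zero]))
  -- `d ^ n ≤ |ι x|` for all `n` is absurd
  have hlt : (ι x).natAbs < d.natAbs ^ (ι x).natAbs := by
    have h2 : 2 ≤ d.natAbs := by omega
    calc (ι x).natAbs < 2 ^ (ι x).natAbs := Nat.lt_two_pow_self
      _ ≤ d.natAbs ^ (ι x).natAbs := Nat.pow_le_pow_left h2 _
  have hdvd := key (ι x).natAbs x
  have hle : d.natAbs ^ (ι x).natAbs ≤ (ι x).natAbs := by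
    have := Int.natAbs_dvd_natAbs.2 hdvd
    rw [Int.natAbs_pow] at this
    exact Nat.le_of_dvd (Int.natAbs_pos.2 hιx) this
  omega

end Literature.AlgebraicTopology.SingularHomology
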